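import Summits.Schanuel.Schanuel.Theorems.RootDecomp1GradedConeCore

/-!
# RootDecomp1GradedConePad — part 2/5 of the port of lens-1 gen 13 «GRADED CONE» (route RootDecomp1 rev 22; THEOREM ROUND, critic VERDICT 2026-08-30T16:07:00Z ACCEPTED, (iii)-partial grade transfer = STRUCTURE currency; port optional-LOW (b))

§§3–4: padding by the monomials t_{j₀}^{d+1}, …, t_{j₀}^{d+j}; the padded tuple is affinely and quadratically non-degenerate under B_N.

Port (census-1 gen 8) of HOME/decomp-schanuel-lens-1/g13/GradedCone.lean (sha256 abae003f…, 1137 l, 74 theorems; rc 0 against rev 22). Hygiene per the critic: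
h1 the graded `def … : Prop` are GRADINGS of the rows S / B / U⊥ / U♮ / Cⁿᵘ (cell definitions of this file, not route items and not cited facts);
h2 explicit `FaithfulSMul` instance kept; h3 the §8 `example` block stays; h4 `ladderCollapseGlue_of_graded` is a plain theorem (26483 closed by p778320);
h5 advisory lint.theses-cone expected (imports Theses.RootDecomp1). Namespace `Summit.Schanuel.Schanuel.Theorems.RootDecomp1GradedCone`; statements and proofs verbatim.
`--supports stmt-Schanuel-29644`. Sorry-free; standard axioms. Nothing here proves Schanuel; rung 0.
-/

noncomputable section

set_option linter.dupNamespace false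

namespace Summit.Schanuel.Schanuel.Theorems.RootDecomp1GradedCone

open Complex IntermediateField
open scoped BigOperators
open Summit.Schanuel.Schanuel.Theses.RootDecomp1 (SchanuelTwo EssentialCounterexamplesInEcl
  DefectOneSchanuel LinearSchanuel QuadraticSchanuel RationalImageSchanuel LadderCollapseGlue
  NonrationalSaturatedEssentialSchanuel closes)
open Summit.Schanuel.Schanuel.Theorems.RootDecomp1EssentialInEcl (essentialCounterexamplesInEcl_holds)
open Literature.NumberTheory.Transcendental (transcendental_exp_holds)
open Literature.NumberTheory.Transcendental.OneMotiveToric (trdeg_mono)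
open Literature.NumberTheory.Transcendental.Philippon1986_criterion (trdeg_adjoin_range_le)
open Literature.Barriers.Schanuel (algebraicIndependent_of_le_trdeg_adjoin
  trdeg_adjoin_union_eq_of_isAlgebraic)
open Summit.Schanuel.Schanuel.Theorems.RootDecomp1LadderCollapse (Qbar quad aeval_mem_adjoin exists_nat_trdeg_range
  algCoeff_map eval_map_Qbar aeval_quad totalDegree_quad_le gadget_rigid)
open Literature.RingTheory.MvPolynomial.Ruppert (totalDegree_pow_of_ne_zero)


/-! ## 3. Padding by the monomials `t_{j₀}^{d+1}, …, t_{j₀}^{d+j}` -/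

/-- The padding polynomial `Σ_{l<j} c_l X_{j₀}^{d+1+l}`. -/
def padPoly {k : ℕ} (j d : ℕ) (j₀ : Fin k) (c : Fin j → Qbar) : MvPolynomial (Fin k) Qbar :=
  ∑ l : Fin j, MvPolynomial.C (c l) * MvPolynomial.X j₀ ^ (d + 1 + (l : ℕ))

/-- Auxiliary fact `coeff_padPoly`: coeff padPoly. -/
theorem coeff_padPoly {k j d : ℕ} (j₀ : Fin k) (c : Fin j → Qbar) (l : Fin j) :
    MvPolynomial.coeff (Finsupp.single j₀ (d + 1 + (l : ℕ))) (padPoly j d j₀ c) = c l := by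
  classical
  simp only [padPoly, MvPolynomial.coeff_sum, MvPolynomial.coeff_C_mul, MvPolynomial.coeff_X_pow]
  rw [Finset.sum_eq_single l]
  · simp
  · intro l' _ hl'
    rw [if_neg, mul_zero]
    intro heq
    apply hl'
    have := Finsupp.single_injective j₀ heq
    exact Fin.ext (by omega)
  · intro h; exact absurd (Finset.mem_univ l) h

/-- Auxiliary fact `padPoly_eq_zero`: padPoly eq zero. -/
theorem padPoly_eq_zero {k j d : ℕ} (j₀ : Fin k) (c : Fin j → Qbar) (h : padPoly j d j₀ c = 0)
    (l : Fin j) : c l = 0 := by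
  rw [← coeff_padPoly j₀ c l (d := d), h, MvPolynomial.coeff_zero]

/-- Auxiliary fact `le_totalDegree_padPoly`: le totalDegree padPoly. -/
theorem le_totalDegree_padPoly {k j d : ℕ} (j₀ : Fin k) (c : Fin j → Qbar)
    (h : padPoly j d j₀ c ≠ 0) : d + 1 ≤ (padPoly j d j₀ c).totalDegree := by
  classical
  obtain ⟨m, hm⟩ := MvPolynomial.ne_zero_iff.mp h
  have hl : ∃ l : Fin j, Finsupp.single j₀ (d + 1 + (l : ℕ)) = m := by
    by_contra hne
    push Not at hne
    apply hm
    simp only [padPoly, MvPolynomial.coeff_sum, MvPolynomial.coeff_C_mul, MvPolynomial.coeff_X_pow]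
    exact Finset.sum_eq_zero fun l _ => by rw [if_neg (hne l), mul_zero]
  obtain ⟨l, rfl⟩ := hl
  have hle := MvPolynomial.le_totalDegree (MvPolynomial.mem_support_iff.mpr hm)
  rw [Finsupp.sum_single_index rfl] at hle
  omega

/-- **The padded tuple is ℚ-linearly independent.**  If `z` is ℚ-l.i., `z_i·D(t) = N_i(t)` with
`deg N_i ≤ d`, `D(t) ≠ 0`, and `t` is algebraically independent over ℚ̄, then
`(z, t_{j₀}^{d+1}, …, t_{j₀}^{d+j})` is ℚ-l.i.: a relation gives `V + W·D = 0` in ℚ̄[T] with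
`deg V ≤ d` and, if `W ≠ 0`, `deg (W·D) ≥ d + 1`. -/
theorem linearIndependent_pad {n k j d : ℕ} (z : Fin n → ℂ) (t : Fin k → ℂ)
    (hz : LinearIndependent ℚ z) (ht : AlgebraicIndependent Qbar t)
    (D : MvPolynomial (Fin k) Qbar) (N : Fin n → MvPolynomial (Fin k) Qbar)
    (hN : ∀ i, (N i).totalDegree ≤ d) (hD0 : MvPolynomial.aeval t D ≠ 0)
    (hzN : ∀ i, z i * MvPolynomial.aeval t D = MvPolynomial.aeval t (N i)) (j₀ : Fin k) :
    LinearIndependent ℚ (Fin.append z (fun l : Fin j => t j₀ ^ (d + 1 + (l : ℕ)))) := by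
  classical
  rw [Fintype.linearIndependent_iff]
  intro g hg
  rw [Fin.sum_univ_add] at hg
  simp only [Fin.append_left, Fin.append_right] at hg
  set W : MvPolynomial (Fin k) Qbar :=
    padPoly j d j₀ (fun l => algebraMap ℚ Qbar (g (Fin.natAdd n l))) with hW
  set V : MvPolynomial (Fin k) Qbar :=
    ∑ i, MvPolynomial.C (algebraMap ℚ Qbar (g (Fin.castAdd j i))) * N i with hV
  have hcoe : ∀ q : ℚ, (algebraMap Qbar ℂ) (algebraMap ℚ Qbar q) = (q : ℂ) := fun q => rfl
  have hVt : MvPolynomial.aeval t V =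
      (∑ i, g (Fin.castAdd j i) • z i) * MvPolynomial.aeval t D := by
    rw [Finset.sum_mul]
    simp only [hV, map_sum, map_mul, MvPolynomial.aeval_C, hcoe, ← hzN, Rat.smul_def]
    exact Finset.sum_congr rfl fun i _ => by ring
  have hWt : MvPolynomial.aeval t W = ∑ l, g (Fin.natAdd n l) • t j₀ ^ (d + 1 + (l : ℕ)) := by
    simp only [hW, padPoly, map_sum, map_mul, map_pow, MvPolynomial.aeval_C, MvPolynomial.aeval_X,
      hcoe, Rat.smul_def]
  have haeval : MvPolynomial.aeval t (V + W * D) = 0 := by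
    rw [map_add, map_mul, hVt, hWt, ← add_mul, hg, zero_mul]
  have hVW : V + W * D = 0 := ht (by rw [haeval, map_zero])
  have hD0' : D ≠ 0 := fun h => hD0 (by rw [h, map_zero])
  have hVdeg : V.totalDegree ≤ d := by
    refine (MvPolynomial.totalDegree_finsetSum _ _).trans (Finset.sup_le fun i _ => ?_)
    refine (MvPolynomial.totalDegree_mul _ _).trans ?_
    rw [MvPolynomial.totalDegree_C, zero_add]
    exact hN i
  have hW0 : W = 0 := by
    by_contra hW0
    have h1 := MvPolynomial.totalDegree_mul_of_isDomain hW0 hD0'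
    have h2 : d + 1 ≤ W.totalDegree := le_totalDegree_padPoly j₀ _ hW0
    have h3 : V = -(W * D) := eq_neg_of_add_eq_zero_left hVW
    have h4 : V.totalDegree = (W * D).totalDegree := by rw [h3, MvPolynomial.totalDegree_neg]
    omega
  have hc0 : ∀ l, g (Fin.natAdd n l) = 0 := by
    intro l
    have h := padPoly_eq_zero j₀ _ hW0 l
    have h' := congrArg (fun x : Qbar => (x : ℂ)) h
    simp only [ZeroMemClass.coe_zero] at h'
    exact_mod_cast (show ((g (Fin.natAdd n l) : ℚ) : ℂ) = 0 from h')
  have hV0 : V = 0 := by rwa [hW0, zero_mul, add_zero] at hVW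
  have ha0 : ∀ i, g (Fin.castAdd j i) = 0 := by
    have h1 : (∑ i, g (Fin.castAdd j i) • z i) * MvPolynomial.aeval t D = 0 := by
      rw [← hVt, hV0, map_zero]
    have h2 : ∑ i, g (Fin.castAdd j i) • z i = 0 := (mul_eq_zero.mp h1).resolve_right hD0
    exact Fintype.linearIndependent_iff.mp hz _ h2
  intro i
  exact Fin.addCases (motive := fun i => g i = 0) ha0 hc0 i

/-! ## 4. The padded tuple is affinely and quadratically non-degenerate (under `B_N`) -/

/-- **Quadratic non-degeneracy of a tuple containing `u^{d+1}` and `u^{d+2}` (`u` transcendental).**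
Under `B_N`, a ℚ-l.i. tuple `x` of length `N` containing the two powers admits no ℚ̄-quadratic
parametrisation (together with `e^x`) by fewer than `N` numbers. -/
theorem pad_quadratic_clause {N d : ℕ} (hB : DefectOneAt N) (hd : 1 ≤ d) (x : Fin N → ℂ)
    (hx : LinearIndependent ℚ x) (u : ℂ) (hu : Transcendental ℚ u) (i₁ i₂ : Fin N)
    (hx₁ : x i₁ = u ^ (d + 1)) (hx₂ : x i₂ = u ^ (d + 2)) : QuadraticClause x := by
  intro k' t' β₀ γ₀ β γ δ ε hβ₀ hβ hδ hγ₀ hγ hε hxr her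
  by_contra hlt
  push Not at hlt
  set P : Fin N → MvPolynomial (Fin k') Qbar := fun i =>
    quad ⟨β₀ i, hβ₀ i⟩ (fun j => ⟨β i j, hβ i j⟩) (fun j j' => ⟨δ i j j', hδ i j j'⟩) with hPdef
  set R : Fin N → MvPolynomial (Fin k') Qbar := fun i =>
    quad ⟨γ₀ i, hγ₀ i⟩ (fun j => ⟨γ i j, hγ i j⟩) (fun j j' => ⟨ε i j j', hε i j j'⟩) with hRdef
  have hxP : ∀ i, x i = MvPolynomial.aeval t' (P i) := fun i => by
    rw [hPdef, aeval_quad]; exact hxr i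
  have hxR : ∀ i, cexp (x i) = MvPolynomial.aeval t' (R i) := fun i => by
    rw [hRdef, aeval_quad]; exact her i
  obtain ⟨hN, ht'⟩ := numerics hB x t' hx 1 P R (by rw [map_one]; exact one_ne_zero)
    (fun i => by rw [map_one, mul_one]; exact hxP i) (fun i => by rw [map_one, mul_one]; exact hxR i) hlt
  have ht'S : AlgebraicIndependent Qbar t' := ht'.subalgebraAlgebraicClosure
  have hu0 : u ≠ 0 := fun h => hu (h ▸ isAlgebraic_zero)
  have h1 : MvPolynomial.aeval t' (P i₁) = u ^ (d + 1) := by rw [← hxP i₁, hx₁]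
  have h2 : MvPolynomial.aeval t' (P i₂) = u ^ (d + 2) := by rw [← hxP i₂, hx₂]
  have hP10 : P i₁ ≠ 0 := fun h => by
    rw [h, map_zero] at h1
    exact pow_ne_zero _ hu0 h1.symm
  have hP20 : P i₂ ≠ 0 := fun h => by
    rw [h, map_zero] at h2
    exact pow_ne_zero _ hu0 h2.symm
  have hid : P i₁ ^ (d + 2) = P i₂ ^ (d + 1) := ht'S (by
    rw [map_pow, map_pow, h1, h2, ← pow_mul, ← pow_mul, Nat.mul_comm])
  have hdeg0 := gadget_rigid hd hP10 hP20 (totalDegree_quad_le _ _ _) (totalDegree_quad_le _ _ _) hid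
  rw [MvPolynomial.totalDegree_eq_zero_iff_eq_C] at hdeg0
  have halg : IsAlgebraic ℚ (u ^ (d + 1)) := by
    rw [← h1, hdeg0, MvPolynomial.aeval_C, Subalgebra.algebraMap_def]
    exact (MvPolynomial.coeff 0 (P i₁)).2
  exact hu.pow (by omega) halg

end Summit.Schanuel.Schanuel.Theorems.RootDecomp1GradedCone
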